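import Literature.Dynamics.Hyperbolic.SequenceShadowingPeriodic

/-!
# Shadowing for a sequence of maps of a Banach space, VI: bounded perturbations of the linear parts
# (the once-per-period jump of a closing argument)

Topic `Literature/Dynamics/Hyperbolic`.  Fully proved complements to Pilyugin's Theorem 1.3.1 as formalised in
`SequenceShadowing{,Green,Existence,Uniqueness,Periodic}.lean`.  There the maps are `φ_k = A_k + w_k` with
`(A, P, B)` a `(λ, N)`-hyperbolic sequence and `w_k` `κ`-Lipschitz on the `Δ`-ball, `κ N₁ < 1`.  In every CLOSING
argument read in charts (Katok 1980 §3; Barreira–Pesin 2023 §11.2; for semiflows Lian–Young 2012) the linear parts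
that are actually hyperbolic for a FIXED splitting are the chart derivatives `A_k` along the reference orbit, while
the maps one must shadow have linear parts `A'_k` which differ from `A_k` ONCE PER PERIOD by the chart mismatch at
the return (`A'_{n-1} = J ∘ A_{n-1}`, `‖J − 1‖` small when the return is close, by continuity of the charts on a
Pesin set), and in general by operators of norm `‖A'_k − A_k‖ ≤ θ`.  A fixed splitting is not invariant under
`A'`, so `(A', P, ·)` is not a hyperbolic sequence; the cheap and classical remedy is to ABSORB the perturbation
into the nonlinearity: relative to `A_k` the nonlinear part `φ_k − A_k = (A'_k − A_k) + (φ_k − A'_k)` is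
`(κ + θ)`-Lipschitz (`lipschitz_nonlin_of_norm_sub_le`), and Theorem 1.3.1 with its sequels applies verbatim with
`κ + θ` in place of `κ` as soon as `(κ + θ) N₁ < 1`:

* `norm_comp_sub_self_le` — the size of a multiplicative jump: `‖J ∘ A − A‖ ≤ ‖J − 1‖ ‖A‖`;
* `lipschitz_nonlin_of_norm_sub_le` — absorption of `‖A'_k − A_k‖ ≤ θ` into the Lipschitz constant;
* `IsHyperbolicSequence.exists_shadow_of_norm_sub_le`, `.shadow_unique_of_norm_sub_le`,
  `.exists_periodic_shadow_of_norm_sub_le`, `.sum_norm_periodic_shadow_le_of_norm_sub_le` — Theorem 1.3.1,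
  uniqueness in the `Δ`-ball, periodic shadows and the `ℓ¹` bound over a period for maps with perturbed linear
  parts, constant `L' = shadowConst λ N (κ + θ)`;
* `IsHyperbolicSequence.exists_periodic_shadow_package_of_norm_sub_le` — the three periodic statements in one:
  the unique `p`-periodic trajectory with `‖v_k‖ ≤ L' d` and `Σ_{k<p} ‖v_k‖ ≤ L' Σ_{k<p} ‖φ_k 0‖`.

Not here: robustness of the SPLITTING under small perturbations (cf. `CLPSplittingPerturbation.lean`,
`SequenceShadowingSkew.lean` for the skew-coupling alternative).

## References

* S. Yu. Pilyugin, *Shadowing in Dynamical Systems*, LNM 1706 (1999), §1.3.1, Theorem 1.3.1. [Pilyugin1999]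
* A. Katok, *Lyapunov exponents, entropy and periodic orbits for diffeomorphisms*, Publ. Math. IHÉS 51 (1980)
  137–173, §3 (Main Lemma). [Katok1980]
-/

noncomputable section

open Set Function

namespace Literature.Dynamics.Hyperbolic

variable {E : Type*} [NormedAddCommGroup E] [NormedSpace ℝ E]

/-! ## §1 Absorbing a bounded perturbation of the linear parts into the nonlinearity -/

/-- **Size of a multiplicative jump**: `‖J ∘ A − A‖ ≤ ‖J − 1‖ · ‖A‖` for bounded operators `J, A`. [folklore] -/
theorem norm_comp_sub_self_le (J A : E →L[ℝ] E) : ‖J.comp A - A‖ ≤ ‖J - 1‖ * ‖A‖ := by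
  have h : J.comp A - A = (J - 1).comp A := by
    rw [ContinuousLinearMap.sub_comp, ContinuousLinearMap.one_def, ContinuousLinearMap.id_comp]
  rw [h]
  exact ContinuousLinearMap.opNorm_comp_le _ _

/-- **Absorption of a bounded perturbation of the linear parts.**  If the nonlinear parts `φ_k − A'_k` are
`κ`-Lipschitz on the ball `‖v‖ ≤ Δ` and `‖A'_k − A_k‖ ≤ θ` for all `k`, then the nonlinear parts RELATIVE TO `A_k`,
`φ_k − A_k = (A'_k − A_k) + (φ_k − A'_k)`, are `(κ + θ)`-Lipschitz on the same ball.  (Typical use: `A' = A` except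
at one index per period, where `A'_k = J ∘ A_k` with `‖J − 1‖ ‖A_k‖ ≤ θ`, `norm_comp_sub_self_le`.) [folklore] -/
theorem lipschitz_nonlin_of_norm_sub_le {A A' : ℤ → E →L[ℝ] E} {φ : ℤ → E → E} {κ θ Δ : ℝ}
    (hLip : ∀ (k : ℤ) (v v' : E), ‖v‖ ≤ Δ → ‖v'‖ ≤ Δ →
      ‖(φ k v - A' k v) - (φ k v' - A' k v')‖ ≤ κ * ‖v - v'‖)
    (hθ : ∀ k, ‖A' k - A k‖ ≤ θ) :
    ∀ (k : ℤ) (v v' : E), ‖v‖ ≤ Δ → ‖v'‖ ≤ Δ →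
      ‖(φ k v - A k v) - (φ k v' - A k v')‖ ≤ (κ + θ) * ‖v - v'‖ := by
  intro k v v' hv hv'
  have e : (φ k v - A k v) - (φ k v' - A k v') =
      ((φ k v - A' k v) - (φ k v' - A' k v')) + (A' k - A k) (v - v') := by
    simp only [FunLike.coe_sub, Pi.sub_apply, map_sub]
    abel
  rw [e, add_mul]
  refine (norm_add_le _ _).trans (add_le_add (hLip k v v' hv hv') ?_)
  exact ((A' k - A k).le_opNorm _).trans (mul_le_mul_of_nonneg_right (hθ k) (norm_nonneg _))

namespace IsHyperbolicSequence

variable {A A' P B : ℤ → E →L[ℝ] E} {lam N : ℝ} [CompleteSpace E]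

/-! ## §2 Theorem 1.3.1 and its sequels for maps with perturbed linear parts -/

/-- **Theorem 1.3.1 with perturbed linear parts.**  Let `(A, P, B)` be `(λ, N)`-hyperbolic on the Banach space `E`,
`‖A'_k − A_k‖ ≤ θ`, and let `φ_k − A'_k` be `κ`-Lipschitz on the `Δ`-ball (`κ, θ ≥ 0`, `(κ + θ) N₁ < 1`).  With
`L' = shadowConst λ N (κ + θ)`: if `‖φ_k 0‖ ≤ d ≤ Δ / L'` then some trajectory `φ_k (v_k) = v_{k+1}` has `‖v_k‖ ≤ L' d`.
[folklore] -/
theorem exists_shadow_of_norm_sub_le (h : IsHyperbolicSequence A P B lam N) {φ : ℤ → E → E} {κ θ Δ d : ℝ}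
    (hκ : 0 ≤ κ) (hθ0 : 0 ≤ θ) (hd : 0 ≤ d) (hκN : (κ + θ) * greenBound lam N < 1)
    (hLip : ∀ (k : ℤ) (v v' : E), ‖v‖ ≤ Δ → ‖v'‖ ≤ Δ →
      ‖(φ k v - A' k v) - (φ k v' - A' k v')‖ ≤ κ * ‖v - v'‖)
    (hθ : ∀ k, ‖A' k - A k‖ ≤ θ) (hφ0 : ∀ k, ‖φ k 0‖ ≤ d) (hdΔ : d ≤ Δ / shadowConst lam N (κ + θ)) :
    ∃ v : ℤ → E, (∀ k, ‖v k‖ ≤ shadowConst lam N (κ + θ) * d) ∧ ∀ k, φ k (v k) = v (k + 1) :=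
  h.exists_shadow (add_nonneg hκ hθ0) hd hκN (lipschitz_nonlin_of_norm_sub_le hLip hθ) hφ0 hdΔ

/-- **Uniqueness in the `Δ`-ball with perturbed linear parts** (under (b') for `A`): two trajectories of `φ` in the
`Δ`-ball coincide. [folklore] -/
theorem shadow_unique_of_norm_sub_le (h : IsHyperbolicSequence A P B lam N)
    (hU : ∀ (k : ℤ), ∀ v ∈ unstableSpace P k, A k v ∈ unstableSpace P (k + 1))
    (hexp : ∀ (k : ℤ), ∀ v ∈ unstableSpace P k, ‖v‖ ≤ lam * ‖A k v‖)
    {φ : ℤ → E → E} {κ θ Δ d : ℝ} (hκ : 0 ≤ κ) (hθ0 : 0 ≤ θ) (hκN : (κ + θ) * greenBound lam N < 1)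
    (hLip : ∀ (k : ℤ) (v v' : E), ‖v‖ ≤ Δ → ‖v'‖ ≤ Δ →
      ‖(φ k v - A' k v) - (φ k v' - A' k v')‖ ≤ κ * ‖v - v'‖)
    (hθ : ∀ k, ‖A' k - A k‖ ≤ θ) (hφ0 : ∀ k, ‖φ k 0‖ ≤ d) {v v' : ℤ → E} (hv : ∀ k, ‖v k‖ ≤ Δ)
    (hv' : ∀ k, ‖v' k‖ ≤ Δ) (htraj : ∀ k, φ k (v k) = v (k + 1)) (htraj' : ∀ k, φ k (v' k) = v' (k + 1)) :
    v = v' :=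
  h.shadow_unique hU hexp (add_nonneg hκ hθ0) hκN (lipschitz_nonlin_of_norm_sub_le hLip hθ) hφ0 hv hv' htraj htraj'

/-- **Periodic shadows with perturbed linear parts**: for `p`-periodic maps `φ_{k+p} = φ_k` the shadowing trajectory
of `exists_shadow_of_norm_sub_le` is `p`-periodic (under (b') for `A`). [folklore] -/
theorem exists_periodic_shadow_of_norm_sub_le (h : IsHyperbolicSequence A P B lam N)
    (hU : ∀ (k : ℤ), ∀ v ∈ unstableSpace P k, A k v ∈ unstableSpace P (k + 1))
    (hexp : ∀ (k : ℤ), ∀ v ∈ unstableSpace P k, ‖v‖ ≤ lam * ‖A k v‖)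
    {φ : ℤ → E → E} {κ θ Δ d : ℝ} (hκ : 0 ≤ κ) (hθ0 : 0 ≤ θ) (hd : 0 ≤ d) (hκN : (κ + θ) * greenBound lam N < 1)
    (hLip : ∀ (k : ℤ) (v v' : E), ‖v‖ ≤ Δ → ‖v'‖ ≤ Δ →
      ‖(φ k v - A' k v) - (φ k v' - A' k v')‖ ≤ κ * ‖v - v'‖)
    (hθ : ∀ k, ‖A' k - A k‖ ≤ θ) (hφ0 : ∀ k, ‖φ k 0‖ ≤ d) (hdΔ : d ≤ Δ / shadowConst lam N (κ + θ))
    {p : ℕ} (hper : ∀ k : ℤ, φ (k + p) = φ k) :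
    ∃ v : ℤ → E, (∀ k, ‖v k‖ ≤ shadowConst lam N (κ + θ) * d) ∧ (∀ k, φ k (v k) = v (k + 1)) ∧
      ∀ k, v (k + p) = v k :=
  h.exists_periodic_shadow hU hexp (add_nonneg hκ hθ0) hd hκN (lipschitz_nonlin_of_norm_sub_le hLip hθ) hφ0 hdΔ hper

/-- **`ℓ¹` bound over a period with perturbed linear parts**: for `p`-periodic `A` and `φ`, every `p`-periodic
trajectory in the `Δ`-ball has `Σ_{k<p} ‖v_k‖ ≤ L' Σ_{k<p} ‖φ_k 0‖`, `L' = shadowConst λ N (κ + θ)` — uniformly in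
`p` (only `A`, not `A'`, needs to be periodic). [folklore] -/
theorem sum_norm_periodic_shadow_le_of_norm_sub_le (h : IsHyperbolicSequence A P B lam N)
    (hU : ∀ (k : ℤ), ∀ v ∈ unstableSpace P k, A k v ∈ unstableSpace P (k + 1))
    (hexp : ∀ (k : ℤ), ∀ v ∈ unstableSpace P k, ‖v‖ ≤ lam * ‖A k v‖)
    {φ : ℤ → E → E} {κ θ Δ d : ℝ} (hκ : 0 ≤ κ) (hθ0 : 0 ≤ θ) (hκN : (κ + θ) * greenBound lam N < 1)
    (hLip : ∀ (k : ℤ) (v v' : E), ‖v‖ ≤ Δ → ‖v'‖ ≤ Δ →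
      ‖(φ k v - A' k v) - (φ k v' - A' k v')‖ ≤ κ * ‖v - v'‖)
    (hθ : ∀ k, ‖A' k - A k‖ ≤ θ) (hφ0 : ∀ k, ‖φ k 0‖ ≤ d) {p : ℕ} (hAper : ∀ k : ℤ, A (k + p) = A k)
    (hφper : ∀ k : ℤ, φ (k + p) = φ k) {v : ℤ → E} (hv : ∀ k, ‖v k‖ ≤ Δ) (htraj : ∀ k, φ k (v k) = v (k + 1))
    (hvper : ∀ k : ℤ, v (k + p) = v k) :
    ∑ k ∈ Finset.range p, ‖v k‖ ≤ shadowConst lam N (κ + θ) * ∑ k ∈ Finset.range p, ‖φ k 0‖ :=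
  h.sum_norm_periodic_shadow_le hU hexp (add_nonneg hκ hθ0) hκN (lipschitz_nonlin_of_norm_sub_le hLip hθ) hφ0
    hAper hφper hv htraj hvper

/-- **The periodic shadowing package with perturbed linear parts (what a closing argument consumes).**  Let `(A, P, B)`
be `(λ, N)`-hyperbolic with (b'), `A` and `φ` `p`-periodic, `‖A'_k − A_k‖ ≤ θ`, `φ_k − A'_k` `κ`-Lipschitz on the
`Δ`-ball, `(κ + θ) N₁ < 1`, `‖φ_k 0‖ ≤ d ≤ Δ / L'`, `L' = shadowConst λ N (κ + θ)`.  Then there is a `p`-PERIODIC trajectory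
`φ_k (v_k) = v_{k+1}` with the sup bound `‖v_k‖ ≤ L' d` AND the `ℓ¹` bound `Σ_{k<p} ‖v_k‖ ≤ L' Σ_{k<p} ‖φ_k 0‖` (and it is
the only trajectory in the `Δ`-ball, `shadow_unique_of_norm_sub_le`). [folklore] -/
theorem exists_periodic_shadow_package_of_norm_sub_le (h : IsHyperbolicSequence A P B lam N)
    (hU : ∀ (k : ℤ), ∀ v ∈ unstableSpace P k, A k v ∈ unstableSpace P (k + 1))
    (hexp : ∀ (k : ℤ), ∀ v ∈ unstableSpace P k, ‖v‖ ≤ lam * ‖A k v‖)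
    {φ : ℤ → E → E} {κ θ Δ d : ℝ} (hκ : 0 ≤ κ) (hθ0 : 0 ≤ θ) (hd : 0 ≤ d) (hκN : (κ + θ) * greenBound lam N < 1)
    (hLip : ∀ (k : ℤ) (v v' : E), ‖v‖ ≤ Δ → ‖v'‖ ≤ Δ →
      ‖(φ k v - A' k v) - (φ k v' - A' k v')‖ ≤ κ * ‖v - v'‖)
    (hθ : ∀ k, ‖A' k - A k‖ ≤ θ) (hφ0 : ∀ k, ‖φ k 0‖ ≤ d) (hdΔ : d ≤ Δ / shadowConst lam N (κ + θ))
    {p : ℕ} (hAper : ∀ k : ℤ, A (k + p) = A k) (hφper : ∀ k : ℤ, φ (k + p) = φ k) :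
    ∃ v : ℤ → E, (∀ k, ‖v k‖ ≤ shadowConst lam N (κ + θ) * d) ∧ (∀ k, φ k (v k) = v (k + 1)) ∧
      (∀ k, v (k + p) = v k) ∧
      ∑ k ∈ Finset.range p, ‖v k‖ ≤ shadowConst lam N (κ + θ) * ∑ k ∈ Finset.range p, ‖φ k 0‖ := by
  obtain ⟨v, hb, ht, hvper⟩ := h.exists_periodic_shadow_of_norm_sub_le hU hexp hκ hθ0 hd hκN hLip hθ hφ0 hdΔ hφper
  have hLpos : 0 < shadowConst lam N (κ + θ) := div_pos h.greenBound_pos (sub_pos.2 hκN)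
  have hLd : shadowConst lam N (κ + θ) * d ≤ Δ := by rwa [le_div_iff₀ hLpos, mul_comm] at hdΔ
  exact ⟨v, hb, ht, hvper, h.sum_norm_periodic_shadow_le_of_norm_sub_le hU hexp hκ hθ0 hκN hLip hθ hφ0 hAper hφper
    (fun k => (hb k).trans hLd) ht hvper⟩

end IsHyperbolicSequence

end Literature.Dynamics.Hyperbolic

end
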